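import Summits.ResolutionOfSingularities.ResolutionOfSingularities.Theorems.EquisingularLiftEquisingularLiftNatDirStepUnobsTransport
import Summits.ResolutionOfSingularities.ResolutionOfSingularities.Theorems.EquisingularLiftEquisingularLiftNatP1VBProjectiveLine
import Literature.AlgebraicGeometry.Modules.RankOneCocycleIso
import Literature.AlgebraicGeometry.Modules.PullbackFrame
import Literature.AlgebraicGeometry.Morphisms.CechModuleCoverIndependence
import Literature.AlgebraicGeometry.Motives.ChernClassesProofs
import HarnessLib

/-!
# [OURS · L1 W4.5(b) · S6 (L) brick C2, sub-brick B3-TRANSFER] The Čech-transfer endgame of brick C2: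
# equal rank-one classes + `Ȟ¹ = 0` on some affine cover ⇒ `Ȟ¹ = 0` on the standard charts of `ℙ¹`

Cell `res-hironaka`, LADDER-RESOLUTION rung L (D-0089), slot W4.5(b), crux chain w45b: working crux
`Theses.EquisingularLift.EquisingularLiftNat` (stmt-ResolutionOfSingularities-20038) / child `EquisingularLiftNatThree`
(stmt-ResolutionOfSingularities-20148); brick C2 of res-L1-w45b-stub-4's `Tower.hLift_of_bricks` (target BY NAME of the registered
socket `stub_elnat_three_liftSections`, child skeleton v23), sub-brick **B3-TRANSFER** = the «Close» step of res-type-027's C2 census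
(`Cruxes/EquisingularLiftNatThree/Lines/C2-CENSUS-res-type-027.md` §1), dealt to res-L1-w45b-stub-2 g9 by the desk (STATUS l.77492 (2));
signature draft `L/res-L1-w45b-stub-2/g9/B3-CechTransfer.sig.lean` 52f7c811f9216826. `--supports stmt-ResolutionOfSingularities-20148
--as helper`. OURS; NOT a statement of any manuscript; AI-written, and AI review is weaker than expert review. No `sorry`, standard axioms,
DEF-FREE.

WHAT. Brick C2 needs `hQ : Ȟ¹((D₊x₀, D₊x₁); 𝓗om(L₀, Q)) = 0` on `ℙ¹_k`; the Euler identification produces, in COCYCLE-CLASS currency, the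
equality of the class of (the transport to `ℙ¹_k` of) the normal sheaf `𝒩_{Γ̃₁/Ẽ₁}` — whose `Ȟ¹` vanishes on SOME affine 2-cover by
`DirStepUnobs` (moved to the root round by B0 `dirStepUnobs_transport`) — with the class of `𝓗om(L₀, Q)`. This file closes:
* `isAffineLocalizing_of_frameSystem` — a module with a frame system is affine-localizing (locally free ⇒ quasi-coherent, Mathlib; tree
  `IsAffineLocalizing.of_isQuasicoherent`);
* **`subsingleton_cechMH1_Dplus_of_cocycle_eq`** (core, on `ℙ¹_A`): `N`, `H` with rank-one frame systems and equal classes in `CechPic`,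
  `Ȟ¹(V; N) = 0` on some affine cover `V` (any index type, no overlap hypothesis) ⇒ `Ȟ¹(D₊; H) = 0` — line bundles with the same class
  are isomorphic (tree `nonempty_iso_of_cocycle_equiv`), `Ȟ¹ = 0` is invariant under isomorphism (`subsingleton_cechMH1_of_iso`) and
  independent of the affine cover (`subsingleton_cechMH1_iff_of_isAffineOpen`; the charts `D₊(x_i)` are affine and cover, tree `P1VB.*`);
* **`subsingleton_cechMH1_Dplus_of_iso_of_detClass_eq`** (with the scheme-isomorphism leg, `detClass`/`HasRank` currency): for
  `Φ : ℙ¹_A ≅ X`, `N` on `X` finite locally free of rank one with `Ȟ¹(V; N) = 0` for ANY structure map `X ⟶ Spec B` (as `DirStepUnobs`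
  hands it, `X.toSpecΓ`) on some affine cover `V` of `X`, and `H` on `ℙ¹_A` finite locally free of rank one with `Φ^*[det N] = [det H]`:
  `Ȟ¹(D₊; H) = 0` (B0's `subsingleton_cechMH1_of_schemeIso` / `subsingleton_cechMH1_iff_of_base`, tree `detClass_pullback`,
  `FrameSystem.pullback`);
* `subsingleton_cechMH1_Dplus_of_iso_of_cocycle_eq` — the same with explicit frame systems (`[F_N^{Φ}] = [F_H]` for the pulled-back
  frame system), for a consumer that computes classes framewise.

References (index only): R. Hartshorne, *Algebraic Geometry* (1977), III Ex. 4.5 (`Pic X ↪ Ȟ¹(X, 𝒪_X^×)`), III Thm. 4.5 (cover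
independence), II Ex. 6.8 (`f^*` on `Pic`) [cite: Hartshorne1977]; The Stacks Project, Tag 01ED [cite: StacksProject].
-/

noncomputable section

-- `TopCat.Presheaf`/`Scheme.Modules` are not reducible (as in Mathlib's `AlgebraicGeometry/Modules`).
set_option backward.isDefEq.respectTransparency false

open CategoryTheory AlgebraicGeometry TopologicalSpace Opposite
open Literature.AlgebraicGeometry.Modules Literature.AlgebraicGeometry.Morphisms Literature.AlgebraicGeometry.Motives


set_option linter.dupNamespace false -- mandated namespace `Summit.<Summit>.<Problem>` of this single-conjunct summit

namespace Summit.ResolutionOfSingularities.ResolutionOfSingularities.Cruxes.EquisingularLiftNat.Sections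

universe u v

/-- A module with a frame system is affine-localizing (it is locally free, hence quasi-coherent). [folklore] -/
theorem isAffineLocalizing_of_frameSystem {X : Scheme.{u}} {H : X.Modules} (FH : FrameSystem H) : IsAffineLocalizing H := by
  haveI := (FH.isFiniteLocallyFree.isVectorBundle).isLocallyFree
  exact IsAffineLocalizing.of_isQuasicoherent H

/-- **B3-TRANSFER (core, on `ℙ¹_A`).** Two `𝒪_{ℙ¹}`-modules `N`, `H` with frame systems of constant rank one and EQUAL cocycle classes in
`CechPic (ℙ¹_A)`; if `Ȟ¹(V; N) = 0` on some family `V` of affine opens covering `ℙ¹_A`, then `Ȟ¹((D₊x₀, D₊x₁); H) = 0`. (Equal classes ⇒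
`N ≅ H`; `Ȟ¹ = 0` moves along the isomorphism and from the affine cover `V` to the standard affine cover.)
[cite: Hartshorne1977, III Ex. 4.5 and III Thm. 4.5] -/
theorem subsingleton_cechMH1_Dplus_of_cocycle_eq {A : Type u} [CommRing A]
    {N H : (ProjCech.PP A 1).Modules} (FN : FrameSystem N) (FH : FrameSystem H)
    (hN1 : ∀ x, FN.rank x = 1) (hH1 : ∀ x, FH.rank x = 1)
    (hcl : CechPic.mk FN.cocycle = CechPic.mk FH.cocycle)
    {ι : Type v} (V : ι → (ProjCech.PP A 1).Opens) (hVaff : ∀ j, IsAffineOpen (V j)) (hVtop : ⨆ j, V j = ⊤)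
    (hN : Subsingleton (CechMH1 (ProjCech.toSpec A 1) N V)) :
    Subsingleton (CechMH1 (ProjCech.toSpec A 1) H (fun i : Fin 2 => ProjCech.Dplus A 1 {i})) := by
  obtain ⟨e⟩ := nonempty_iso_of_cocycle_equiv FN FH hN1 hH1 hcl
  have hV : Subsingleton (CechMH1 (ProjCech.toSpec A 1) H V) := subsingleton_cechMH1_of_iso _ V e.symm hN
  exact (subsingleton_cechMH1_iff_of_isAffineOpen (ProjCech.toSpec A 1) (isAffineLocalizing_of_frameSystem FH) V
    (fun i : Fin 2 => ProjCech.Dplus A 1 {i}) hVaff (fun i => P1VB.isAffineOpen_Dplus_singleton A 1 i) hVtop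
    (P1VB.iSup_Dplus_singleton_eq_top A 1)).mp hV

/-- **B3-TRANSFER with the scheme-isomorphism leg, frame-system currency.** `Φ : ℙ¹_A ≅ X`; `N` on `X` with a frame system `FN` of
constant rank one and `Ȟ¹(V; N) = 0` for some structure map `f : X ⟶ Spec B` (any ring `B`, e.g. `X.toSpecΓ`) on some family `V` of
affine opens covering `X`; `H` on `ℙ¹_A` with a frame system `FH` of constant rank one; and the classes of the PULLED-BACK frame system
`FN.pullback Φ.hom` and of `FH` agree in `CechPic (ℙ¹_A)`. Then `Ȟ¹((D₊x₀, D₊x₁); H) = 0`.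
[cite: Hartshorne1977, III Ex. 4.5, III Thm. 4.5 and II Ex. 6.8] -/
theorem subsingleton_cechMH1_Dplus_of_iso_of_cocycle_eq {A : Type u} [CommRing A]
    {X : Scheme.{u}} (Φ : ProjCech.PP A 1 ≅ X) {B : Type u} [CommRing B] (f : X ⟶ Spec (.of B))
    {N : X.Modules} (FN : FrameSystem N) (hN1 : ∀ x, FN.rank x = 1)
    {ι : Type v} (V : ι → X.Opens) (hVaff : ∀ j, IsAffineOpen (V j)) (hVtop : ⨆ j, V j = ⊤)
    (hN : Subsingleton (CechMH1 f N V))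
    {H : (ProjCech.PP A 1).Modules} (FH : FrameSystem H) (hH1 : ∀ x, FH.rank x = 1)
    (hcl : CechPic.mk (FN.pullback Φ.hom).cocycle = CechPic.mk FH.cocycle) :
    Subsingleton (CechMH1 (ProjCech.toSpec A 1) H (fun i : Fin 2 => ProjCech.Dplus A 1 {i})) := by
  -- `Φ_* Φ^* N ≅ N` (`Φ^* ≅ (Φ⁻¹)_*` for an isomorphism)
  have e' : (Scheme.Modules.pushforward Φ.symm.inv).obj ((Scheme.Modules.pullback Φ.hom).obj N) ≅ N :=
    (Scheme.Modules.pushforward Φ.hom).mapIso (pullbackInvIsoPushforward Φ.symm N) ≪≫ (isoPushforwardInvPushforward Φ.symm N).symm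
  -- `Ȟ¹ = 0` for `Φ^* N` on the transported cover, any structure map
  have h₁ : Subsingleton (CechMH1 (Φ.hom ≫ f) ((Scheme.Modules.pullback Φ.hom).obj N) (preimageFamily Φ.hom V)) :=
    subsingleton_cechMH1_of_schemeIso f N V Φ.symm (Φ.hom ≫ f) rfl e' hN
  have h₂ : Subsingleton (CechMH1 (ProjCech.toSpec A 1) ((Scheme.Modules.pullback Φ.hom).obj N) (preimageFamily Φ.hom V)) :=
    (subsingleton_cechMH1_iff_of_base _ _ _ _).mp h₁
  exact subsingleton_cechMH1_Dplus_of_cocycle_eq (FN.pullback Φ.hom) FH (fun x => hN1 _) hH1 hcl (preimageFamily Φ.hom V)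
    (fun j => (hVaff j).preimage_of_isIso Φ.hom) (Φ.hom.iSup_preimage_eq_top hVtop) h₂

/-- **B3-TRANSFER with the scheme-isomorphism leg, `detClass`/`HasRank` currency.** `Φ : ℙ¹_A ≅ X` (in brick C2: `X = Γ̃₁`,
`Φ = ψ ≫ (V(Ī) = Z̃₀) ≫ δ₁⁻¹`); `N` on `X` finite locally free of rank one (the normal sheaf) with `Ȟ¹(V; N) = 0` for some structure map
`f : X ⟶ Spec B` on some family `V` of affine opens covering `X` (what `DirStepUnobs` hands, via B0); `H` on `ℙ¹_A` finite locally free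
of rank one (`𝓗om(L₀, Q)`, tree `isFiniteLocallyFree_sheafHom_of_hasRank_one`); and `Φ^*[det N] = [det H]` in `CechPic (ℙ¹_A)`. Then
`Ȟ¹((D₊x₀, D₊x₁); H) = 0` — the hypothesis `hQ` of T-P1VB. [cite: Hartshorne1977, III Ex. 4.5, III Thm. 4.5 and II Ex. 6.8] -/
theorem subsingleton_cechMH1_Dplus_of_iso_of_detClass_eq {A : Type u} [CommRing A]
    {X : Scheme.{u}} (Φ : ProjCech.PP A 1 ≅ X) {B : Type u} [CommRing B] (f : X ⟶ Spec (.of B))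
    {N : X.Modules} (hNf : IsFiniteLocallyFree N) (hN1 : HasRank N 1)
    {ι : Type v} (V : ι → X.Opens) (hVaff : ∀ j, IsAffineOpen (V j)) (hVtop : ⨆ j, V j = ⊤)
    (hN : Subsingleton (CechMH1 f N V))
    {H : (ProjCech.PP A 1).Modules} (hHf : IsFiniteLocallyFree H) (hH1 : HasRank H 1)
    (hcl : CechPic.pullback Φ.hom (detClass hNf) = detClass hHf) :
    Subsingleton (CechMH1 (ProjCech.toSpec A 1) H (fun i : Fin 2 => ProjCech.Dplus A 1 {i})) := by
  obtain ⟨FN, hFN⟩ := exists_frameSystem_of_hasRank hN1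
  obtain ⟨FH, hFH⟩ := exists_frameSystem_of_hasRank hH1
  have hcl' : CechPic.mk (FN.pullback Φ.hom).cocycle = CechPic.mk FH.cocycle := by
    rw [← detClass_eq_mk (hNf.pullback Φ.hom) (FN.pullback Φ.hom), detClass_pullback Φ.hom hNf, hcl, detClass_eq_mk hHf FH]
  exact subsingleton_cechMH1_Dplus_of_iso_of_cocycle_eq Φ f FN hFN V hVaff hVtop hN FH hFH hcl'


/-- **B3-TRANSFER, `DirStepUnobs`-shaped input** (APPEND, res-L1-w45b-lead-2 g4). Same as
`subsingleton_cechMH1_Dplus_of_iso_of_detClass_eq`, with the vanishing hypothesis packaged EXACTLY as `DirStepUnobs` (tree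
`…NatDirZeroDefs`) hands it for a given closed immersion — an affine 2-cover of `X` with affine overlap on which `Ȟ¹(V; N) = 0` for the
structure map `X.toSpecΓ` — so that the C2 assembly (`…NatDirLiftUnobsAssembly`) destructures nothing. [cite: Hartshorne1977, III Ex. 4.5] -/
theorem subsingleton_cechMH1_Dplus_of_iso_of_detClass_eq_of_exists {A : Type u} [CommRing A]
    {X : Scheme.{u}} (Φ : ProjCech.PP A 1 ≅ X)
    {N : X.Modules} (hNf : IsFiniteLocallyFree N) (hN1 : HasRank N 1)
    (hN : ∃ V : Fin 2 → X.Opens, (∀ j, IsAffineOpen (V j)) ∧ IsAffineOpen (V 0 ⊓ V 1) ∧ ⨆ j, V j = ⊤ ∧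
      Subsingleton (CechMH1 X.toSpecΓ N V))
    {H : (ProjCech.PP A 1).Modules} (hHf : IsFiniteLocallyFree H) (hH1 : HasRank H 1)
    (hcl : CechPic.pullback Φ.hom (detClass hNf) = detClass hHf) :
    Subsingleton (CechMH1 (ProjCech.toSpec A 1) H (fun i : Fin 2 => ProjCech.Dplus A 1 {i})) := by
  obtain ⟨V, hVaff, -, hVtop, hV⟩ := hN
  exact subsingleton_cechMH1_Dplus_of_iso_of_detClass_eq Φ X.toSpecΓ hNf hN1 V hVaff hVtop hV hHf hH1 hcl

end Summit.ResolutionOfSingularities.ResolutionOfSingularities.Cruxes.EquisingularLiftNat.Sections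

end
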